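import Mathlib
import Literature.Analysis.FluidPDE.WholeSpaceIBP
import Literature.Analysis.FluidPDE.ClassicalSolutionCalculus
import HarnessLib

/-!
# Crux `NoFrozenEddyCollapse` (stmt-NavierStokesRegularity-1431), line `SketchIdeator1`:
  STUB `stub_noShellBalance` — partial result: the GLOBAL ENERGY SHELL LAW (`f ≡ 1`)

Helper file (lands `--supports stmt-NavierStokesRegularity-1431`) for the registered stub
`stub_noShellBalance` of the skeleton `NoFrozenEddyCollapse` (card `shell-balance-edge-torsion`).

The stub asks: no nonzero smooth compactly supported steady Euler flow `(U, P)` has its frozen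
drift `𝓛̃U = ΔU − αℓ²U − (ℓ²/2) DU·y` `L²`-orthogonal to all Bernoulli-shell fields `f(B) U` and
`g(B) curl U`.  This file records the `f ≡ 1` member of the energy family in closed form:

* `integral_inner_laplacian_self_eq_neg_integral_frobeniusNormSq` — Green without boundary for a
  compactly supported `C²` field, `∫ ⟪ΔU, U⟫ = −∫ |DU|²_F`
  (`integral_inner_laplacian_add_eq_zero` with `v = w = U`, `frobeniusNormSq_eq_sum`);
* `integral_inner_fderiv_apply_id_self` — the dilation identity `∫ ⟪DU(y) y, U y⟫ = −(3/2) ∫ ‖U‖²`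
  (trilinear identity `integral_inner_convect_add_eq_zero` with the field `y ↦ y`, `div y = 3`);
* `integral_inner_frozenDrift_self` — hence, unconditionally for `U ∈ C²_c`,
  `∫ ⟪ΔU − αℓ²U − (ℓ²/2) DU·y, U⟫ = −∫ |DU|²_F + ℓ²(3/4 − α) ∫ ‖U‖²`;
* `shellEnergy_one` (registered helper stub) — under the energy-shell hypothesis of
  `stub_noShellBalance` (tested at `f ≡ 1`): `∫ |DU|²_F = ℓ²(3/4 − α) ∫ ‖U‖²` (the Leray length is
  fixed by the profile; for `α ≥ 3/4` this alone would force `U = 0`: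
  `eq_zero_of_shellEnergy_of_le`, recorded, outside the crux's range `α < 3/4`).
Mathlib + `Literature.Analysis.FluidPDE.{WholeSpaceIBP, ClassicalSolutionCalculus}` only.
-/

noncomputable section

open MeasureTheory Set Filter Topology Metric Function
open scoped RealInnerProductSpace

namespace Summit.NavierStokesRegularity.NavierStokesRegularity.Theorems.NoFrozenEddyCollapse.ShellBalanceEdgeTorsion

open Literature.Analysis.FluidPDE

/-- The divergence of the identity field `y ↦ y` on `ℝ³` is `3`. -/
private theorem divergence_id_three (y : EuclideanSpace ℝ (Fin 3)) :
    VectorCalculus.divergence (fun z : EuclideanSpace ℝ (Fin 3) => z) y = 3 := by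
  rw [VectorCalculus.divergence]
  have : (fderiv ℝ (fun z : EuclideanSpace ℝ (Fin 3) => z) y :
      EuclideanSpace ℝ (Fin 3) →ₗ[ℝ] EuclideanSpace ℝ (Fin 3)) = LinearMap.id := by
    rw [show (fun z : EuclideanSpace ℝ (Fin 3) => z) = id from rfl, fderiv_id]; rfl
  rw [this, LinearMap.trace_id, finrank_euclideanSpace_fin]
  norm_num

/-- **Green's identity without boundary for a compactly supported field**: for
`U ∈ C²_c(ℝ³; ℝ³)`, `∫ ⟪ΔU, U⟫ = −∫ |DU|²_F` (Frobenius norm of the velocity gradient;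
`integral_inner_laplacian_add_eq_zero` with both slots equal to `U`). -/
theorem integral_inner_laplacian_self_eq_neg_integral_frobeniusNormSq
    {U : EuclideanSpace ℝ (Fin 3) → EuclideanSpace ℝ (Fin 3)} (hU : ContDiff ℝ 2 U)
    (hc : HasCompactSupport U) :
    ∫ y, ⟪Laplacian.laplacian U y, U y⟫ = -∫ y, frobeniusNormSq (fderiv ℝ U y) := by
  set b := stdOrthonormalBasis ℝ (EuclideanSpace ℝ (Fin 3)) with hb
  have hU1 : ContDiff ℝ 1 U := hU.of_le one_le_two
  have h := integral_inner_laplacian_add_eq_zero b hU hU1 (Or.inl hc)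
  have hi : ∀ i, Integrable (fun y => ⟪fderiv ℝ U y (b i), fderiv ℝ U y (b i)⟫)
      (volume : Measure (EuclideanSpace ℝ (Fin 3))) := fun i =>
    integrable_inner_of_hasCompactSupport_right
      ((hU1.continuous_fderiv one_ne_zero).clm_apply continuous_const)
      ((hU1.continuous_fderiv one_ne_zero).clm_apply continuous_const)
      ((hc.fderiv (𝕜 := ℝ)).mono fun x hx => by
        contrapose! hx; simp only [mem_support, not_not] at hx; simp [hx])
  have hsum : ∑ i, ∫ y, ⟪fderiv ℝ U y (b i), fderiv ℝ U y (b i)⟫ =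
      ∫ y, frobeniusNormSq (fderiv ℝ U y) := by
    rw [← integral_finsetSum _ fun i _ => hi i]
    refine integral_congr_ae (Eventually.of_forall fun y => ?_)
    simp only [frobeniusNormSq_eq_sum b, real_inner_self_eq_norm_sq]
  linarith

/-- **Dilation identity**: for `U ∈ C¹_c(ℝ³; ℝ³)`, `∫ ⟪DU(y) y, U y⟫ = −(3/2) ∫ ‖U‖²`
(the trilinear identity `∫ ⟪(u·∇)v, w⟫ + ∫ ⟪v, (u·∇)w⟫ + ∫ div u ⟪v, w⟫ = 0` with `u = id`,
`v = w = U`, `div id = 3`; equivalently `d/dλ|₁ ∫ ‖U(λy)‖² dy = −3 ∫ ‖U‖²`). -/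
theorem integral_inner_fderiv_apply_id_self
    {U : EuclideanSpace ℝ (Fin 3) → EuclideanSpace ℝ (Fin 3)} (hU : ContDiff ℝ 1 U)
    (hc : HasCompactSupport U) :
    ∫ y, ⟪fderiv ℝ U y y, U y⟫ = -(3 / 2) * ∫ y, ‖U y‖ ^ 2 := by
  have h := integral_inner_convect_add_eq_zero (u := fun z : EuclideanSpace ℝ (Fin 3) => z)
    (v := U) (w := U) contDiff_id hU hU hc
  simp only [convect, divergence_id_three] at h
  rw [integral_const_mul] at h
  have hcomm : ∫ y, ⟪U y, fderiv ℝ U y y⟫ = ∫ y, ⟪fderiv ℝ U y y, U y⟫ :=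
    integral_congr_ae (Eventually.of_forall fun y => real_inner_comm _ _)
  have hsq : ∫ y, ⟪U y, U y⟫ = ∫ y, ‖U y‖ ^ 2 :=
    integral_congr_ae (Eventually.of_forall fun y => real_inner_self_eq_norm_sq _)
  rw [hcomm, hsq] at h
  linarith

/-- **The frozen drift against the profile** (unconditional, `U ∈ C²_c`):
`∫ ⟪ΔU − αℓ²U − (ℓ²/2) DU·y, U⟫ = −∫ |DU|²_F + ℓ²(3/4 − α) ∫ ‖U‖²`. -/
theorem integral_inner_frozenDrift_self (α ℓ : ℝ)
    {U : EuclideanSpace ℝ (Fin 3) → EuclideanSpace ℝ (Fin 3)} (hU : ContDiff ℝ 2 U)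
    (hc : HasCompactSupport U) :
    ∫ y, ⟪Laplacian.laplacian U y - (α * ℓ ^ 2) • U y - (ℓ ^ 2 / 2) • fderiv ℝ U y y, U y⟫ =
      -(∫ y, frobeniusNormSq (fderiv ℝ U y)) + ℓ ^ 2 * (3 / 4 - α) * ∫ y, ‖U y‖ ^ 2 := by
  have hU1 : ContDiff ℝ 1 U := hU.of_le one_le_two
  have hUc : Continuous U := hU.continuous
  have iL : Integrable (fun y => ⟪Laplacian.laplacian U y, U y⟫)
      (volume : Measure (EuclideanSpace ℝ (Fin 3))) :=
    integrable_inner_of_hasCompactSupport_right (continuous_laplacian hU) hUc hc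
  have iP : Integrable (fun y => ⟪U y, U y⟫) (volume : Measure (EuclideanSpace ℝ (Fin 3))) :=
    integrable_inner_of_hasCompactSupport_right hUc hUc hc
  have iD : Integrable (fun y => ⟪fderiv ℝ U y y, U y⟫)
      (volume : Measure (EuclideanSpace ℝ (Fin 3))) :=
    integrable_inner_of_hasCompactSupport_right
      ((hU.continuous_fderiv two_ne_zero).clm_apply continuous_id) hUc hc
  have key : ∀ y, ⟪Laplacian.laplacian U y - (α * ℓ ^ 2) • U y - (ℓ ^ 2 / 2) • fderiv ℝ U y y,
      U y⟫ = ⟪Laplacian.laplacian U y, U y⟫ - (α * ℓ ^ 2) * ⟪U y, U y⟫ -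
        (ℓ ^ 2 / 2) * ⟪fderiv ℝ U y y, U y⟫ := fun y => by
    simp only [inner_sub_left, real_inner_smul_left]
  simp_rw [key]
  have hsplit : ∫ y, (⟪Laplacian.laplacian U y, U y⟫ - (α * ℓ ^ 2) * ⟪U y, U y⟫ -
      (ℓ ^ 2 / 2) * ⟪fderiv ℝ U y y, U y⟫) =
      ((∫ y, ⟪Laplacian.laplacian U y, U y⟫) - (α * ℓ ^ 2) * ∫ y, ⟪U y, U y⟫) -
        (ℓ ^ 2 / 2) * ∫ y, ⟪fderiv ℝ U y y, U y⟫ := by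
    rw [integral_sub, integral_sub, integral_const_mul, integral_const_mul]
    all_goals first
      | exact iL
      | exact iP.const_mul _
      | exact iD.const_mul _
      | exact iL.sub (iP.const_mul _)
  have hsq : ∫ y, ⟪U y, U y⟫ = ∫ y, ‖U y‖ ^ 2 :=
    integral_congr_ae (Eventually.of_forall fun y => real_inner_self_eq_norm_sq _)
  rw [hsplit, integral_inner_laplacian_self_eq_neg_integral_frobeniusNormSq hU hc,
    integral_inner_fderiv_apply_id_self hU1 hc, hsq]
  ring

/-- **GLOBAL ENERGY SHELL LAW** (`f ≡ 1` in the energy-shell hypothesis of `stub_noShellBalance`;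
registered helper stub of crux `NoFrozenEddyCollapse`, line `SketchIdeator1`).  If the frozen drift
of a smooth compactly supported `U` is `L²`-orthogonal to every `f(P + ‖U‖²/2) U`, `f` smooth, then
`∫ |DU|²_F = ℓ²(3/4 − α) ∫ ‖U‖²`: test with `f ≡ 1` and use `integral_inner_frozenDrift_self`.
Uses only `ContDiff ⊤ U`, `HasCompactSupport U` and the `f ≡ 1` balance (`P`, Euler, `div U = 0`
are NOT used). -/
theorem shellEnergy_one :
    ∀ (α ℓ : ℝ) (U : EuclideanSpace ℝ (Fin 3) → EuclideanSpace ℝ (Fin 3))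
      (P : EuclideanSpace ℝ (Fin 3) → ℝ),
      ContDiff ℝ (⊤ : ℕ∞) U → HasCompactSupport U →
      (∀ f : ℝ → ℝ, ContDiff ℝ (⊤ : ℕ∞) f →
        ∫ y, inner ℝ (Laplacian.laplacian U y - (α * ℓ ^ 2) • U y - (ℓ ^ 2 / 2) • (fderiv ℝ U y) y)
            (f (P y + ‖U y‖ ^ 2 / 2) • U y) = 0) →
      ∫ y, frobeniusNormSq (fderiv ℝ U y) = ℓ ^ 2 * (3 / 4 - α) * ∫ y, ‖U y‖ ^ 2 := by
  intro α ℓ U P hU hc hE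
  have hU2 : ContDiff ℝ 2 U := hU.of_le (WithTop.coe_le_coe.2 le_top)
  have h := hE (fun _ => 1) contDiff_const
  simp only [one_smul] at h
  rw [integral_inner_frozenDrift_self α ℓ hU2 hc] at h
  linarith

/-- Corollary recorded for the standing disprover: for `α > 3/4` (OUTSIDE the crux's window
`α ∈ (1/2, 3/4)`) the global energy shell law alone forces `U = 0`, since then
`0 ≤ ∫ |DU|²_F = ℓ²(3/4 − α) ∫ ‖U‖² ≤ 0` gives `∫ ‖U‖² = 0`, and a continuous function with
vanishing `L²` norm is zero.  (At `α = 3/4` one gets `DU ≡ 0`, hence `U = 0` by compact support;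
not recorded.)  Inside the window the law only fixes the ratio `∫|DU|²_F / ∫‖U‖² = ℓ²(3/4 − α)`. -/
theorem eq_zero_of_shellEnergy_of_lt :
    ∀ (α ℓ : ℝ) (U : EuclideanSpace ℝ (Fin 3) → EuclideanSpace ℝ (Fin 3))
      (P : EuclideanSpace ℝ (Fin 3) → ℝ),
      3 / 4 < α → 0 < ℓ → ContDiff ℝ (⊤ : ℕ∞) U → HasCompactSupport U →
      (∀ f : ℝ → ℝ, ContDiff ℝ (⊤ : ℕ∞) f →
        ∫ y, inner ℝ (Laplacian.laplacian U y - (α * ℓ ^ 2) • U y - (ℓ ^ 2 / 2) • (fderiv ℝ U y) y)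
            (f (P y + ‖U y‖ ^ 2 / 2) • U y) = 0) →
      U = 0 := by
  intro α ℓ U P hα hℓ hU hc hE
  have h := shellEnergy_one α ℓ U P hU hc hE
  have hF : 0 ≤ ∫ y, frobeniusNormSq (fderiv ℝ U y) :=
    integral_nonneg fun y => frobeniusNormSq_nonneg _
  have hN : 0 ≤ ∫ y, ‖U y‖ ^ 2 := integral_nonneg fun y => sq_nonneg _
  have hcoef : ℓ ^ 2 * (3 / 4 - α) < 0 :=
    mul_neg_of_pos_of_neg (pow_pos hℓ 2) (by linarith)
  have hint : ∫ y, ‖U y‖ ^ 2 = 0 := by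
    by_contra hne
    have hpos : 0 < ∫ y, ‖U y‖ ^ 2 := lt_of_le_of_ne hN (Ne.symm hne)
    have : ℓ ^ 2 * (3 / 4 - α) * ∫ y, ‖U y‖ ^ 2 < 0 := mul_neg_of_neg_of_pos hcoef hpos
    linarith
  -- a continuous nonnegative integrable function with zero integral vanishes
  have hUc : Continuous U := hU.continuous
  have hi : Integrable (fun y => ‖U y‖ ^ 2) (volume : Measure (EuclideanSpace ℝ (Fin 3))) :=
    (hUc.norm.pow 2).integrable_of_hasCompactSupport
      (hc.mono fun x hx => by
        contrapose! hx; simp only [mem_support, not_not] at hx; simp [hx])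
  have hae := (integral_eq_zero_iff_of_nonneg (fun y => sq_nonneg _) hi).1 hint
  have hzero : (fun y => ‖U y‖ ^ 2) = 0 :=
    Continuous.ae_eq_iff_eq volume (hUc.norm.pow 2) continuous_const |>.1 hae
  funext y
  have := congr_fun hzero y
  simpa using this
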